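import Summits.Ventures.HodgeRepro2.DiagonalKleinFour

/-!
# KleinFourProjectors — the explicit isotypic projectors of two commuting involutions, and the SIGN
DECOMPOSITION of every form on `Γ_N` of the record's Picard form (p2 annex row 170)

Cell pub-hodge-repro2, Tier 5 kernel annex (seat p2, Shimura-data / Hecke side). One definition (`proj`), the
rest proof lane.
§8(d): uses an L-value-free non-vanishing device: NO.

Generic part (`…HodgeRepro2.CommutingInvolutions`, Mathlib only): for two commuting involutive linear maps `T₀, T₁`
of a complex module the projector `P_{ε₀ε₁} v = ¼ (v + ε₀ T₀ v + ε₁ T₁ v + ε₀ε₁ T₀ T₁ v)` (`proj`) satisfies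
`T₀ P_ε v = ε₀ P_ε v`, `T₁ P_ε v = ε₁ P_ε v` (`map_proj_left`, `map_proj_right`) and
`v = P_{++} v + P_{+−} v + P_{−+} v + P_{−−} v` (`sum_four_proj`).
Application (`…ShimuraData`): on the compact-quotient Petersson space of `Γ_N` of a coordinate lattice for the
record's Picard form `H_a = diag(1,1,a)`, with `T₀ = T_{w₀}`, `T₁ = T_{w₁}` the Hecke operators of two coordinate
sign changes (row 169: normalising, commuting, involutive by row 148), EVERY form `v` is the sum of its four
sign components, each a joint eigenvector with signs `(ε₀, ε₁)` (`heckeFamilyOf_proj_coordSignU`,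
`sum_four_proj_coordSignU`) — the explicit form of row 169's sign decomposition.

No `sorry`; `#print axioms` ⊆ {propext, Classical.choice, Quot.sound}.
-/

namespace Summit.Ventures.HodgeRepro2.CommutingInvolutions

variable {V : Type*} [AddCommGroup V] [Module ℂ V] (T₀ T₁ : V →ₗ[ℂ] V)

/-- The isotypic projector `P_{ε₀ε₁} v = ¼ (v + ε₀ T₀ v + ε₁ T₁ v + ε₀ε₁ T₀ T₁ v)`. -/
noncomputable def proj (ε₀ ε₁ : ℂ) (v : V) : V :=
  (4 : ℂ)⁻¹ • (v + ε₀ • T₀ v + ε₁ • T₁ v + (ε₀ * ε₁) • T₀ (T₁ v))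

variable {T₀ T₁}

/-- `T₀ P_{ε₀ε₁} v = ε₀ P_{ε₀ε₁} v` for `T₀² = 1`, `T₀ T₁ = T₁ T₀`, `ε₀² = 1`. -/
theorem map_proj_left (h0 : ∀ v, T₀ (T₀ v) = v) (hc : ∀ v, T₀ (T₁ v) = T₁ (T₀ v)) {ε₀ : ℂ}
    (hε : ε₀ * ε₀ = 1) (ε₁ : ℂ) (v : V) : T₀ (proj T₀ T₁ ε₀ ε₁ v) = ε₀ • proj T₀ T₁ ε₀ ε₁ v := by
  simp only [proj, map_smul, map_add, smul_add, smul_smul, h0, hc]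
  linear_combination (norm := module) hε • ((-(4 : ℂ)⁻¹) • T₀ v + (-(4 : ℂ)⁻¹ * ε₁) • T₁ (T₀ v))

/-- `T₁ P_{ε₀ε₁} v = ε₁ P_{ε₀ε₁} v` for `T₁² = 1`, `T₀ T₁ = T₁ T₀`, `ε₁² = 1`. -/
theorem map_proj_right (h1 : ∀ v, T₁ (T₁ v) = v) (hc : ∀ v, T₀ (T₁ v) = T₁ (T₀ v)) (ε₀ : ℂ) {ε₁ : ℂ}
    (hε : ε₁ * ε₁ = 1) (v : V) : T₁ (proj T₀ T₁ ε₀ ε₁ v) = ε₁ • proj T₀ T₁ ε₀ ε₁ v := by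
  simp only [proj, map_smul, map_add, smul_add, smul_smul, ← hc, h1]
  linear_combination (norm := module) hε • ((-(4 : ℂ)⁻¹) • T₁ v + (-(4 : ℂ)⁻¹ * ε₀) • T₀ (T₁ v))

/-- Every vector is the sum of its four sign components. -/
theorem sum_four_proj (v : V) :
    proj T₀ T₁ 1 1 v + proj T₀ T₁ 1 (-1) v + proj T₀ T₁ (-1) 1 v + proj T₀ T₁ (-1) (-1) v = v := by
  simp only [proj]
  module

end Summit.Ventures.HodgeRepro2.CommutingInvolutions

namespace Summit.Ventures.HodgeRepro2.ShimuraData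

open Summit.Ventures.HodgeRepro2.CommutingInvolutions

variable {K : Type*} [Field K] [NumberField K] [NumberField.IsCMField K]
  {τ₁ : K →+* ℂ} {a : NumberField.maximalRealSubfield K} {Q : Matrix (Fin 3) (Fin 3) ℂ}
  (hQ : IsFrame K τ₁ (Matrix.diagonal ![1, 1, (algebraMap (NumberField.maximalRealSubfield K) K) a]) Q)
  {𝔪 : Submodule ℤ (Fin 3 → K)} (hcoord : ∀ x ∈ 𝔪, ∀ i : Fin 3, Pi.single i (x i) ∈ 𝔪) {N : ℕ}
  [CompactSpace (ballQuotient hQ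
    (shimuraLevelSubgroup K (Matrix.diagonal ![1, 1, (algebraMap (NumberField.maximalRealSubfield K) K) a]) 𝔪 N)
    (shimuraLevelSubgroup_subset_unitaryGroup
      (Matrix.diagonal ![1, 1, (algebraMap (NumberField.maximalRealSubfield K) K) a]) 𝔪 N))]
  {D : Set ball₂} (k : ℕ)
  (hD : IsBallFundamentalDomain hQ
    (shimuraLevelSubgroup K (Matrix.diagonal ![1, 1, (algebraMap (NumberField.maximalRealSubfield K) K) a]) 𝔪 N)
    (shimuraLevelSubgroup_subset_unitaryGroup
      (Matrix.diagonal ![1, 1, (algebraMap (NumberField.maximalRealSubfield K) K) a]) 𝔪 N) D)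
  (hDm : MeasurableSet D)
  (inst : ∀ δ : unitaryGroup K
    (Matrix.diagonal ![1, 1, (algebraMap (NumberField.maximalRealSubfield K) K) a]),
    Fintype (shimuraLevelSubgroup K
      (Matrix.diagonal ![1, 1, (algebraMap (NumberField.maximalRealSubfield K) K) a]) 𝔪 N ⧸
      (heckeSubgroup (shimuraLevelSubgroup K
        (Matrix.diagonal ![1, 1, (algebraMap (NumberField.maximalRealSubfield K) K) a]) 𝔪 N)
        (δ : GL (Fin 3) K)).subgroupOf (shimuraLevelSubgroup K
        (Matrix.diagonal ![1, 1, (algebraMap (NumberField.maximalRealSubfield K) K) a]) 𝔪 N)))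

include hcoord in
/-- `T_{w_i} ∘ T_{w_i} = id` on the Petersson space of `Γ_N` (row 148 with row 169's normalisation). -/
theorem heckeFamilyOf_coordSignU_sq (i : Fin 3) (v : PeterssonSpace hQ _ _ k hD) :
    heckeFamilyOf hQ _ _ k hD hDm inst (coordSignU a i) (heckeFamilyOf hQ _ _ k hD hDm inst (coordSignU a i) v)
      = v := by
  have hnorm : ∀ s : GL (Fin 3) K,
      s ∈ shimuraLevelSubgroup K (Matrix.diagonal ![1, 1, (algebraMap (NumberField.maximalRealSubfield K) K) a])
        𝔪 N ↔ (coordSignU a i : GL (Fin 3) K) * s * (coordSignU a i : GL (Fin 3) K)⁻¹ ∈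
        shimuraLevelSubgroup K (Matrix.diagonal ![1, 1, (algebraMap (NumberField.maximalRealSubfield K) K) a])
          𝔪 N :=
    coordSignGL_normalizes_shimuraLevel_diagonal a hcoord i N
  have hsq : (coordSignU a i : GL (Fin 3) K) * coordSignU a i = 1 := coordSignGL_mul_self i
  exact heckeFamilyOf_heckeFamilyOf_eq_self_of_normalizes_of_sq_eq_one hQ _ _ k hD hDm inst hnorm hsq v

include hcoord in
/-- `T_{w₀} T_{w₁} = T_{w₁} T_{w₀}` on the Petersson space of `Γ_N` (row 169). -/
theorem heckeFamilyOf_coordSignU_comm (v : PeterssonSpace hQ _ _ k hD) :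
    heckeFamilyOf hQ _ _ k hD hDm inst (coordSignU a 0) (heckeFamilyOf hQ _ _ k hD hDm inst (coordSignU a 1) v)
      = heckeFamilyOf hQ _ _ k hD hDm inst (coordSignU a 1)
        (heckeFamilyOf hQ _ _ k hD hDm inst (coordSignU a 0) v) := by
  have hnorm : ∀ i : Fin 3, ∀ s : GL (Fin 3) K,
      s ∈ shimuraLevelSubgroup K (Matrix.diagonal ![1, 1, (algebraMap (NumberField.maximalRealSubfield K) K) a])
        𝔪 N ↔ (coordSignU a i : GL (Fin 3) K) * s * (coordSignU a i : GL (Fin 3) K)⁻¹ ∈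
        shimuraLevelSubgroup K (Matrix.diagonal ![1, 1, (algebraMap (NumberField.maximalRealSubfield K) K) a])
          𝔪 N :=
    fun i => coordSignGL_normalizes_shimuraLevel_diagonal a hcoord i N
  have hc : coordSignU a 1 * coordSignU a 0 = coordSignU a 0 * coordSignU a 1 :=
    Subtype.ext (coordSignGL_mul_comm 1 0)
  exact heckeFamilyOf_comm_of_normalizes_both hQ _ _ k hD hDm inst (hnorm 1) (hnorm 0) hc v

include hcoord in
/-- The four sign components `P_{ε₀ε₁} v` of a form on `Γ_N` are joint eigenvectors of `T_{w₀}`, `T_{w₁}` with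
signs `(ε₀, ε₁)`. -/
theorem heckeFamilyOf_proj_coordSignU {ε₀ ε₁ : ℂ} (h0 : ε₀ * ε₀ = 1) (h1 : ε₁ * ε₁ = 1)
    (v : PeterssonSpace hQ _ _ k hD) :
    heckeFamilyOf hQ _ _ k hD hDm inst (coordSignU a 0)
        (proj (heckeFamilyOf hQ _ _ k hD hDm inst (coordSignU a 0))
          (heckeFamilyOf hQ _ _ k hD hDm inst (coordSignU a 1)) ε₀ ε₁ v) =
        ε₀ • proj (heckeFamilyOf hQ _ _ k hD hDm inst (coordSignU a 0))
          (heckeFamilyOf hQ _ _ k hD hDm inst (coordSignU a 1)) ε₀ ε₁ v ∧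
      heckeFamilyOf hQ _ _ k hD hDm inst (coordSignU a 1)
        (proj (heckeFamilyOf hQ _ _ k hD hDm inst (coordSignU a 0))
          (heckeFamilyOf hQ _ _ k hD hDm inst (coordSignU a 1)) ε₀ ε₁ v) =
        ε₁ • proj (heckeFamilyOf hQ _ _ k hD hDm inst (coordSignU a 0))
          (heckeFamilyOf hQ _ _ k hD hDm inst (coordSignU a 1)) ε₀ ε₁ v :=
  ⟨map_proj_left (heckeFamilyOf_coordSignU_sq hQ hcoord k hD hDm inst 0)
      (heckeFamilyOf_coordSignU_comm hQ hcoord k hD hDm inst) h0 ε₁ v,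
    map_proj_right (heckeFamilyOf_coordSignU_sq hQ hcoord k hD hDm inst 1)
      (heckeFamilyOf_coordSignU_comm hQ hcoord k hD hDm inst) ε₀ h1 v⟩

/-- Every form on `Γ_N` is the sum of its four sign components. -/
theorem sum_four_proj_coordSignU (v : PeterssonSpace hQ _ _ k hD) :
    proj (heckeFamilyOf hQ _ _ k hD hDm inst (coordSignU a 0))
        (heckeFamilyOf hQ _ _ k hD hDm inst (coordSignU a 1)) 1 1 v +
      proj (heckeFamilyOf hQ _ _ k hD hDm inst (coordSignU a 0))
        (heckeFamilyOf hQ _ _ k hD hDm inst (coordSignU a 1)) 1 (-1) v +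
      proj (heckeFamilyOf hQ _ _ k hD hDm inst (coordSignU a 0))
        (heckeFamilyOf hQ _ _ k hD hDm inst (coordSignU a 1)) (-1) 1 v +
      proj (heckeFamilyOf hQ _ _ k hD hDm inst (coordSignU a 0))
        (heckeFamilyOf hQ _ _ k hD hDm inst (coordSignU a 1)) (-1) (-1) v = v :=
  sum_four_proj v

end Summit.Ventures.HodgeRepro2.ShimuraData
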